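import Summits.BirchSwinnertonDyer.BirchSwinnertonDyer.Theorems.PrintCf2DisegniPairTwoDisegniGZPairEight
import Literature.NumberTheory.EllipticCurves.CanonicalPAdicHeightCycExistenceTwoProofs
import HarnessLib

/-!
# Road (C) `disegni-pair-two` on crux stmt-BirchSwinnertonDyer-20368 — the stub `stub_existsCanonicalCyc_two`
# (existence of THE canonical cyclotomic `2`-adic height datum ON THE FRAME) CLOSED by the tree theorem

Cell `bsd-print-cf2` (`run/shared/lean/pub/bsd-print-cf2/`), LEAD seat `bsd-line-cf2-p1` g23. `--supports
stmt-BirchSwinnertonDyer-20368` (registered stub of skeleton v3.8 `Lines/disegni_pair_two.lean`, sha16 ff7ba91179c2ccde, by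
name and signature). THEOREM ONLY (no `def`, no named fact, no `sorry`). BSD is not proved by any of this; no summit statement is
claimed; 20368 is not closed here.

## What is proved, and why

v3.8 of the line moved the S0′ print `WeierstrassCurve.exists_isCanonicalCyc` (the global all-`(W, p, H)` existence of the canonical
cyclotomic `p`-adic height datum, [MST06 §2.6–2.8]) to a theorem-stub in FRAME currency: for `V/ℚ` globally minimal, good ordinary at
`2`, with a Mazur–Tate sigma-squared pair at `2`, and any number field `H` with `V ⊗ H` globally minimal, a canonical cyclotomic `2`-adic
`H`-datum exists and is `Aut(H/ℚ)`-invariant. The width seat `bsd-line-cf2-p1-w8` (g28) proved the STRONGER statement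
`Literature.NumberTheory.EllipticCurves.exists_isCanonicalCyc_two_of_pair` (p811403, `CanonicalPAdicHeightCycExistenceTwoProofs.lean`:
`W` merely `ℤ`-integral, `H` arbitrary, no ordinarity; programme G2/G1+G3/G4/A1–A5, ten files). The stub follows by one application
(`[V.IsGloballyMinimal] ⇒ [V.IsIntegral ℤ]` is the tree instance `IsGloballyMinimal.isIntegral_int`).

References: B. Mazur, W. Stein, J. Tate, Doc. Math. Extra Vol. Coates (2006) §2.6–2.8 [MazurSteinTate2006]; J. Silverman, Math. Ann.
332 (2005) §5 Rem. 2 [Silverman2005DivPoly]; P. Schneider, Invent. Math. 69 (1982) §1 [Schneider1982].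
-/

set_option autoImplicit false
set_option linter.dupNamespace false

noncomputable section

open scoped Classical NumberField

open NumberField IsDedekindDomain WeierstrassCurve Literature.NumberTheory.EllipticCurves

namespace Summit.BirchSwinnertonDyer.BirchSwinnertonDyer.Cruxes.SplitBadTwoRankOneOfFacts.DisegniPairTwoV3

/-- **`stub_existsCanonicalCyc_two` (skeleton v3.8 of `Lines/disegni_pair_two.lean`), PROVED**: for `V/ℚ` globally minimal with good
ordinary reduction at `2` whose `2`-adic model carries a Mazur–Tate sigma-squared pair, and every number field `H` with `V ⊗ H`
globally minimal, there is a height datum `DH₀` on `V(H)` which is canonical for the cyclotomic `2`-adic height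
(`PAdicHeightDataK.IsCanonicalCyc`) and invariant under `Aut(H/ℚ)` — a specialisation of the width seat's
`exists_isCanonicalCyc_two_of_pair` (the ordinarity and minimality hypotheses are not used).
[cite: MazurSteinTate2006, §2.6–2.8 (PDF p. 10 L7 – p. 11 L58)] [cite: Silverman2005DivPoly, §5 Thm. 11 and Rem. 2] -/
theorem stub_existsCanonicalCyc_two :
    ∀ (V : WeierstrassCurve ℚ) [V.IsElliptic] [V.IsGloballyMinimal] (H : Type) [Field H] [NumberField H]
      [(V.baseChange H).IsGloballyMinimal],
      IsOrdinaryAt V 2 →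
      (∃ Sq : PowerSeries ℚ_[2], ∃ c : ℚ_[2], (V.baseChange ℚ_[2]).IsMazurTateSigmaSqPair Sq c) →
      ∃ DH₀ : PAdicHeightDataK V 2 H, DH₀.IsCanonicalCyc ∧
        ∀ (σ : H ≃ₐ[ℚ] H) (a b : (V.baseChange H).toAffine.Point),
          DH₀.pairing (pointGalHom V H σ a) (pointGalHom V H σ b) = DH₀.pairing a b :=
  fun V _ _ H _ _ _ _ hpair => exists_isCanonicalCyc_two_of_pair V H hpair

end Summit.BirchSwinnertonDyer.BirchSwinnertonDyer.Cruxes.SplitBadTwoRankOneOfFacts.DisegniPairTwoV3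

end
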